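import Mathlib
import Summits.ValiantsHypothesis.ValiantsHypothesis.Theorems.NewtonUnitEquationsNewtonTauWeakVdpDefs

/-!
# `NewtonTauWeak` (stmt-ValiantsHypothesis-5904), line `euler-wronskian-vdp`: leading term of the Euler–Wronskian

Stub `stub_leadingTermWronskian` of the lead's skeleton: if `v_0,…,v_{r-1} ∈ ℂ[X,Y]` have strict
`w`-tops `e_0,…,e_{r-1}` which are pairwise distinct, then the Euler–Wronskian
`W(v) = det[θ^a v_b]_{a,b<r}` (over the slope ring `ℂ[μ]`) has strict `w`-top `Σ_b e_b`.

Proof: the multilinear expansion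
`W(v) = Σ_{φ ∈ Π_b supp v_b} X^{Σ_b φ b} · det[⟨ν,φ b⟩^a]_{a,b} · Π_b C(coeff_{φ b} v_b)`
(`Matrix.det_apply'`, `Finset.prod_univ_sum`); for `φ ≠ e` the exponent `Σ φ` has strictly smaller
`w`-degree than `Σ e` (`IsTop.lt`, `wdeg_sum`), so the coefficient of `X^{Σ e}` is the single term
`φ = e`, a transposed Vandermonde determinant of the pairwise distinct Euler weights `⟨ν, e_b⟩` times a
product of nonzero constants, nonzero in the domain `ℂ[μ]` (`Matrix.det_vandermonde_ne_zero_iff`,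
`eulerWeight_injective`). [KPT arXiv:1205.1015 §2 (real analogue); folklore]
-/

-- the namespace mandated for this Theorems file repeats the component `ValiantsHypothesis`
set_option linter.dupNamespace false

noncomputable section

namespace Summit.ValiantsHypothesis.ValiantsHypothesis.Theorems.NewtonUnitEquationsNewtonTauWeak

open scoped BigOperators Polynomial
open MvPolynomial
open Literature.Computability.AlgebraicComplexity (newtonVertexCount)
open Summit.ValiantsHypothesis.ValiantsHypothesis.Theorems.NewtonTauWeakVdp

namespace LeadingTerm

/-- A finite product of monomials is the monomial of the summed exponents. [folklore] -/
theorem prod_monomial {ι σ R : Type*} [CommSemiring R] (s : Finset ι) (f : ι → σ →₀ ℕ)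
    (c : ι → R) : ∏ i ∈ s, monomial (f i) (c i) = monomial (∑ i ∈ s, f i) (∏ i ∈ s, c i) := by
  classical
  induction s using Finset.induction_on with
  | empty => simp
  | insert a s ha ih =>
    rw [Finset.prod_insert ha, Finset.sum_insert ha, Finset.prod_insert ha, ih, monomial_mul]

/-- Base change written as a sum of monomials over the support. [folklore] -/
theorem baseChange_eq_sum (p : MvPolynomial (Fin 2) ℂ) :
    baseChange p = ∑ f ∈ p.support, monomial f (Polynomial.C (coeff f p)) := by
  classical
  ext g
  rw [coeff_baseChange, coeff_sum]
  simp only [coeff_monomial]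
  rw [Finset.sum_ite_eq' p.support g]
  split_ifs with h
  · rfl
  · rw [notMem_support_iff.mp h, map_zero]

/-- The entries of the Euler–Wronskian matrix as sums of monomials:
`θ^a (baseChange p) = Σ_{f ∈ supp p} ⟨ν,f⟩^a C(coeff_f p) X^f`. [folklore] -/
theorem euler_iterate_baseChange_eq_sum (a : ℕ) (p : MvPolynomial (Fin 2) ℂ) :
    euler^[a] (baseChange p) =
      ∑ f ∈ p.support, monomial f (eulerWeight f ^ a * Polynomial.C (coeff f p)) := by
  rw [baseChange_eq_sum, euler_iterate_sum]
  simp only [euler_iterate_monomial]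

/-- One term of the Leibniz expansion: the product of the entries along a permutation is a sum of
monomials over the tuples `φ ∈ Π_b supp v_b`. [folklore] -/
theorem prod_entries_eq_sum {r : ℕ} (v : Fin r → MvPolynomial (Fin 2) ℂ) (σ : Equiv.Perm (Fin r)) :
    ∏ i, (Matrix.of fun a b : Fin r => euler^[(a : ℕ)] (baseChange (v b))) (σ i) i =
      ∑ φ ∈ Fintype.piFinset (fun b => (v b).support),
        monomial (∑ b, φ b)
          (∏ b, (eulerWeight (φ b) ^ ((σ b : Fin r) : ℕ) * Polynomial.C (coeff (φ b) (v b)))) := by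
  classical
  simp only [Matrix.of_apply, euler_iterate_baseChange_eq_sum]
  rw [Finset.prod_univ_sum]
  refine Finset.sum_congr rfl fun φ _ => ?_
  rw [prod_monomial]

/-- **Multilinear expansion of the Euler–Wronskian**:
`W(v) = Σ_{φ ∈ Π_b supp v_b} X^{Σ_b φ b} · (det[⟨ν,φ b⟩^a]_{a,b} · Π_b C(coeff_{φ b} v_b))`. [folklore] -/
theorem eulerWronskian_expand {r : ℕ} (v : Fin r → MvPolynomial (Fin 2) ℂ) :
    eulerWronskian (fun b => baseChange (v b)) =
      ∑ φ ∈ Fintype.piFinset (fun b => (v b).support),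
        monomial (∑ b, φ b) ((Matrix.of fun a b : Fin r => eulerWeight (φ b) ^ (a : ℕ)).det *
          ∏ b, Polynomial.C (coeff (φ b) (v b))) := by
  classical
  unfold eulerWronskian
  rw [Matrix.det_apply']
  simp_rw [prod_entries_eq_sum, Finset.mul_sum]
  rw [Finset.sum_comm]
  refine Finset.sum_congr rfl fun φ _ => ?_
  have hint : ∀ σ : Equiv.Perm (Fin r),
      ((Equiv.Perm.sign σ : ℤ) : MvPolynomial (Fin 2) Slope) *
        monomial (∑ b, φ b)
          (∏ b, (eulerWeight (φ b) ^ ((σ b : Fin r) : ℕ) * Polynomial.C (coeff (φ b) (v b)))) =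
      monomial (∑ b, φ b) (((Equiv.Perm.sign σ : ℤ) : Slope) *
          ∏ b, (eulerWeight (φ b) ^ ((σ b : Fin r) : ℕ) * Polynomial.C (coeff (φ b) (v b)))) := by
    intro σ
    rw [← map_intCast (C : Slope →+* MvPolynomial (Fin 2) Slope), C_mul_monomial]
  simp_rw [hint]
  rw [← map_sum (monomial (∑ b, φ b))]
  congr 1
  rw [Matrix.det_apply', Finset.sum_mul]
  refine Finset.sum_congr rfl fun σ _ => ?_
  simp only [Matrix.of_apply]
  rw [Finset.prod_mul_distrib, mul_assoc]

/-- Every exponent in the support of `W(v)` is `Σ_b φ b` for a tuple `φ ∈ Π_b supp v_b`. [folklore] -/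
theorem exists_of_mem_support {r : ℕ} (v : Fin r → MvPolynomial (Fin 2) ℂ) {g : Fin 2 →₀ ℕ}
    (hg : g ∈ (eulerWronskian fun b => baseChange (v b)).support) :
    ∃ φ ∈ Fintype.piFinset (fun b => (v b).support), ∑ b, φ b = g := by
  classical
  rw [eulerWronskian_expand] at hg
  obtain ⟨φ, hφ, hg'⟩ := Finset.mem_biUnion.mp (support_sum hg)
  exact ⟨φ, hφ, (Finset.mem_singleton.mp (support_monomial_subset hg')).symm⟩

/-- If the tuple `e ∈ Π_b supp v_b` is the only tuple with exponent sum `Σ_b e b`, then the coefficient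
of `X^{Σ e}` in `W(v)` is `det[⟨ν,e b⟩^a] · Π_b C(coeff_{e b} v_b)`. [folklore] -/
theorem coeff_top {r : ℕ} (v : Fin r → MvPolynomial (Fin 2) ℂ) {e : Fin r → (Fin 2 →₀ ℕ)}
    (hmem : e ∈ Fintype.piFinset fun b => (v b).support)
    (huniq : ∀ φ ∈ Fintype.piFinset (fun b => (v b).support), ∑ b, φ b = ∑ b, e b → φ = e) :
    coeff (∑ b, e b) (eulerWronskian fun b => baseChange (v b)) =
      (Matrix.of fun a b : Fin r => eulerWeight (e b) ^ (a : ℕ)).det *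
        ∏ b, Polynomial.C (coeff (e b) (v b)) := by
  classical
  rw [eulerWronskian_expand, coeff_sum]
  simp only [coeff_monomial]
  rw [Finset.sum_eq_single e]
  · rw [if_pos rfl]
  · intro φ hφ hne
    rw [if_neg]
    exact fun h => hne (huniq φ hφ h)
  · intro h
    exact absurd hmem h

/-- A tuple `φ ∈ Π_b supp v_b` other than the tuple of tops has strictly smaller total `w`-degree.
[folklore] -/
theorem wdeg_sum_lt {r : ℕ} {v : Fin r → MvPolynomial (Fin 2) ℂ} {w : Fin 2 → ℝ}
    {e : Fin r → (Fin 2 →₀ ℕ)} (he : ∀ b, IsTop w (v b) (e b)) {φ : Fin r → (Fin 2 →₀ ℕ)}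
    (hφ : φ ∈ Fintype.piFinset fun b => (v b).support) (hne : φ ≠ e) :
    wdeg w (∑ b, φ b) < wdeg w (∑ b, e b) := by
  rw [wdeg_sum, wdeg_sum]
  obtain ⟨b, hb⟩ := Function.ne_iff.mp hne
  rw [Fintype.mem_piFinset] at hφ
  exact Finset.sum_lt_sum (fun i _ => (he i).le (hφ i)) ⟨b, Finset.mem_univ _, (he b).lt (hφ b) hb⟩

/-- The transposed Vandermonde determinant `det[x_b^a]_{a,b}` of pairwise distinct elements of the
domain `ℂ[μ]` is nonzero. [folklore] -/
theorem det_pow_ne_zero {r : ℕ} {x : Fin r → Slope} (hx : Function.Injective x) :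
    (Matrix.of fun a b : Fin r => x b ^ (a : ℕ)).det ≠ 0 := by
  have h : (Matrix.of fun a b : Fin r => x b ^ (a : ℕ)) = (Matrix.vandermonde x).transpose := by
    ext a b
    simp [Matrix.vandermonde_apply]
  rw [h, Matrix.det_transpose]
  exact Matrix.det_vandermonde_ne_zero_iff.mpr hx

end LeadingTerm

/-- **Leading term of the Euler–Wronskian.**  If `v_0,…,v_{r-1} ∈ ℂ[X,Y]` have strict `w`-tops
`e_0,…,e_{r-1}` which are pairwise distinct, then `W(v) = det[θ^a v_b]_{a,b<r}` has strict `w`-top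
`Σ_b e_b`: in the multilinear expansion (`LeadingTerm.eulerWronskian_expand`) every tuple `φ ≠ e`
has `wdeg(Σφ) < wdeg(Σe)` (`LeadingTerm.wdeg_sum_lt`), and the `φ = e` coefficient is
`det(vandermonde (⟨ν,e_b⟩)_b)ᵀ · Π_b C(coeff_{e_b} v_b) ≠ 0` (`eulerWeight_injective`, `ℂ[μ]` a domain).
Genericity of `w` is not needed. [KPT arXiv:1205.1015 §2 (real analogue); folklore] -/
theorem stub_leadingTermWronskian :
    ∀ (r : ℕ) (v : Fin r → MvPolynomial (Fin 2) ℂ) (w : Fin 2 → ℝ), IsGeneric w →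
      ∀ (e : Fin r → (Fin 2 →₀ ℕ)), (∀ b, IsTop w (v b) (e b)) → Function.Injective e →
        IsTop w (eulerWronskian fun b => baseChange (v b)) (∑ b, e b) := by
  intro r v w _ e he hinj
  classical
  have hmem : e ∈ Fintype.piFinset fun b => (v b).support :=
    Fintype.mem_piFinset.mpr fun b => (he b).mem
  have huniq : ∀ φ ∈ Fintype.piFinset (fun b => (v b).support), ∑ b, φ b = ∑ b, e b → φ = e := by
    intro φ hφ hsum
    by_contra hne
    exact (LeadingTerm.wdeg_sum_lt he hφ hne).ne (by rw [hsum])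
  refine ⟨?_, fun g hg hne => ?_⟩
  · rw [mem_support_iff, LeadingTerm.coeff_top v hmem huniq]
    refine mul_ne_zero (LeadingTerm.det_pow_ne_zero (eulerWeight_injective.comp hinj)) ?_
    exact Finset.prod_ne_zero_iff.mpr fun b _ =>
      Polynomial.C_ne_zero.mpr (mem_support_iff.mp (he b).mem)
  · obtain ⟨φ, hφ, rfl⟩ := LeadingTerm.exists_of_mem_support v hg
    exact LeadingTerm.wdeg_sum_lt he hφ fun h => hne (by rw [h])

end Summit.ValiantsHypothesis.ValiantsHypothesis.Theorems.NewtonUnitEquationsNewtonTauWeak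

end
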